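import Literature.NumberTheory.EllipticCurves.AnomalousOfRationalTorsionProofs
import Literature.NumberTheory.EllipticCurves.ModularityVersionApProofs
import Literature.NumberTheory.EllipticCurves.LFunctionPrimeCoeff
import Literature.NumberTheory.EllipticCurves.RootNumberAtkinLehnerSemistableProofs
import Literature.NumberTheory.EllipticCurves.RootNumberTwistProofs
import Literature.NumberTheory.EllipticCurves.ShortWeierstrassGoodTwistLocalProofs
import Literature.NumberTheory.DiophantineGeometry.ConductorMultiplicativeProofs
import Literature.NumberTheory.DiophantineGeometry.ConductorAdditiveProofs
import Literature.NumberTheory.EllipticCurves.Greenberg1999.TwoTorsionMuInvariant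
import Summits.BirchSwinnertonDyer.BirchSwinnertonDyer.Theorems.EisensteinDepletionAtTwoStarGO2KEtaThetaPattern
import HarnessLib

/-!
# Route `EisensteinDepletionAtTwo`, crux `StarGO2Sigma` (stmt-BirchSwinnertonDyer-27046), line `kummer` v7 (registered) —
# KA: the PARITY PATTERN of `a_n(E)` for a curve with a rational `2`-torsion point

planner bsd-rank2-p2 GEN 38, PART 17 (evidence for 27046; the "Eisenstein congruence mod 2" input of step (iii) of the registered
stub K-Θ `stub_etaKummerTheta`: "`a_p` even at odd good `p`, `a₂` odd, `a_ℓ = ±1` at `ℓ ∥ N`, `a_ℓ = 0` at `ℓ² ∣ N`, multiplicativity").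

THE CLAIM (KA of HOME/p2/g38/KUMMER-V7-DESIGN.md §3, here PROVED sorry-free): for `W / ℚ` elliptic and globally minimal with a
rational point of order `2` (`HasRationalTwoTorsionX W x₀`) and every ODD `n`,
`a_n(W)` is odd ⟺ `LevelPattern N_W n` :⟺ `n ≠ 0` and every prime `p ∣ n` is either good for `W` (`v_p N = 0`) with `v_p n` even,
or multiplicative (`v_p N = 1`).

PROOF.  `a_n = ∏_p a_{p^{v_p n}}` (multiplicativity, tree `isMultiplicative_LFunction`), so `a_n` is odd iff every `a_{p^e}` is.
Per odd prime `p`, with `f_p = v_p(N_W) = ` the conductor exponent (tree `factorization_conductorNorm_eq_conductorExponent`):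
* `f_p = 0` (good): the rational `2`-torsion point reduces to a point of order `2` of `Ẽ(𝔽_p)` (tree
  `addOrderOf_dvd_reductionPointCount`, `p ≥ 3`), so `N_p` is even and `a_p = p + 1 − N_p` is EVEN; the Hecke recursion
  `a_{p^{k+2}} = a_p a_{p^{k+1}} − p a_{p^k}` (tree `LFunction_apply_prime_pow_add_two_of_prime`) with `p` odd gives
  `a_{p^e} ≡ a_{p^{e-2}}`, whence `a_{p^e}` odd ⟺ `e` even;
* `f_p = 1` (multiplicative, tree `conductorExponent_eq_one_iff_holds`): `a_p = ±1` and `a_{p^e} = a_p^e` is odd;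
* `f_p ≥ 2` (additive, tree `two_le_conductorExponent_iff_holds`): `a_m = 0` for `p ∣ m` (tree
  `LFunction_apply_eq_zero_of_hasAdditiveReductionAt`).
[cite: DiamondShurman2005, §8.8 (8.44)] [cite: SilvermanAEC2009, VII.3.1(b)]
-/

set_option autoImplicit false
set_option linter.dupNamespace false

noncomputable section

open scoped Classical
open WeierstrassCurve IsDedekindDomain NumberField Rat.HeightOneSpectrum
open Literature.NumberTheory.EllipticCurves Literature.NumberTheory.EllipticCurves.Greenberg1999

namespace Summit.BirchSwinnertonDyer.BirchSwinnertonDyer.Theorems.DepletionAtTwo.KEta.ApParity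

open Summit.BirchSwinnertonDyer.BirchSwinnertonDyer.Theorems.DepletionAtTwo.KEta.ThetaPattern (LevelPattern)

/-! ## §1 Layer 1 — parity bookkeeping for multiplicative functions and two-step recursions -/

/-- A finite product of integers is odd iff every factor is. [folklore] -/
theorem odd_prod_iff {ι : Type*} (s : Finset ι) (f : ι → ℤ) :
    Odd (∏ i ∈ s, f i) ↔ ∀ i ∈ s, Odd (f i) := by
  induction s using Finset.induction_on with
  | empty => simp
  | insert a s ha ih => rw [Finset.prod_insert ha, Int.odd_mul, ih, Finset.forall_mem_insert]

/-- For a multiplicative `f` and `n ≠ 0`: `f n` is odd iff every `f (p^{v_p n})` is. [folklore] -/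
theorem odd_apply_iff (f : ArithmeticFunction ℤ) (hf : f.IsMultiplicative) {n : ℕ} (hn : n ≠ 0) :
    Odd (f n) ↔ ∀ p ∈ n.primeFactors, Odd (f (p ^ n.factorization p)) := by
  rw [hf.multiplicative_factorization f hn, Finsupp.prod, Nat.support_factorization, odd_prod_iff]

/-- Two-step recursion with EVEN first coefficient and ODD constant: `g (k+2) = g 1·g (k+1) − c·g k`, `g 0 = 1` ⇒
(`g e` odd ⟺ `e` even). [folklore] -/
theorem odd_iff_even_of_rec (g : ℕ → ℤ) (c : ℤ) (h0 : g 0 = 1) (h1 : Even (g 1)) (hc : Odd c)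
    (hrec : ∀ k, g (k + 2) = g 1 * g (k + 1) - c * g k) : ∀ e, Odd (g e) ↔ Even e := by
  intro e
  induction e using Nat.strong_induction_on with
  | _ e ih =>
    match e, ih with
    | 0, _ => rw [h0]; exact iff_of_true odd_one Even.zero
    | 1, _ => exact iff_of_false (Int.not_odd_iff_even.mpr h1) (by decide)
    | e + 2, ih =>
      have ih' : Odd (g e) ↔ Even e := ih e (by omega)
      have he2 : Even (e + 2) ↔ Even e := by
        rw [Nat.even_add]; exact iff_true_right (by decide) |>.trans Iff.rfl |>.symm.symm
      have h1' : ¬ Odd (g 1) := Int.not_odd_iff_even.mpr h1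
      have hge : Even (g e) ↔ ¬ Odd (g e) := Int.not_odd_iff_even.symm
      rw [hrec e, Int.odd_sub, Int.odd_mul, Int.even_mul, he2, ← ih', hge]
      have hc' : ¬ Even c := Int.not_even_iff_odd.mpr hc
      tauto

/-- Two-step recursion with ODD first coefficient and ZERO constant: `g (k+2) = g 1·g (k+1)`, `g 0 = 1` ⇒ every `g e` odd.
[folklore] -/
theorem odd_of_rec (g : ℕ → ℤ) (h0 : g 0 = 1) (h1 : Odd (g 1)) (hrec : ∀ k, g (k + 2) = g 1 * g (k + 1)) :
    ∀ e, Odd (g e) := by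
  intro e
  induction e using Nat.strong_induction_on with
  | _ e ih =>
    match e, ih with
    | 0, _ => rw [h0]; exact odd_one
    | 1, _ => exact h1
    | e + 2, ih => rw [hrec e]; exact Int.odd_mul.mpr ⟨h1, ih (e + 1) (by omega)⟩

/-! ## §2 Layer 2 — the elliptic-curve dictionary at an odd prime -/

variable (W : WeierstrassCurve ℚ) [W.IsElliptic] [W.IsGloballyMinimal]

/-- **A rational `2`-torsion point makes `a_p` EVEN at every odd good prime**: the point `T = (x₀, y)` with `2y + a₁x₀ + a₃ = 0`
has order `2` in `E(ℚ)`, so `2 ∣ #Ẽ(𝔽_p)` (reduction is injective on torsion at a good `p ≥ 3`) and `a_p = p + 1 − #Ẽ(𝔽_p)` is even.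
[cite: SilvermanAEC2009, VII.3.1(b)] -/
theorem even_LFunction_prime_of_good {x₀ : ℚ} (hx : HasRationalTwoTorsionX W x₀) (p : ℕ) [Fact p.Prime] (hp2 : p ≠ 2)
    (hgood : W.HasGoodReductionAtPrime p) : Even (W.LFunction p) := by
  have hp : p.Prime := Fact.out
  have hp3 : 3 ≤ p := by have := hp.two_le; omega
  obtain ⟨y, heq, hy⟩ := hx
  have hns : W.toAffine.Nonsingular x₀ y := (WeierstrassCurve.Affine.equation_iff_nonsingular).mp heq
  have hyneg : y = W.toAffine.negY x₀ y := by
    rw [WeierstrassCurve.Affine.negY]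
    change y = -y - W.a₁ * x₀ - W.a₃
    linarith
  have h2T : 2 • (WeierstrassCurve.Affine.Point.some x₀ y hns) = 0 := by
    rw [two_nsmul]; exact WeierstrassCurve.Affine.Point.add_self_of_Y_eq hyneg
  have hT : addOrderOf (WeierstrassCurve.Affine.Point.some x₀ y hns) = 2 :=
    addOrderOf_eq_prime h2T (WeierstrassCurve.Affine.Point.some_ne_zero hns)
  have hfin : IsOfFinAddOrder (WeierstrassCurve.Affine.Point.some x₀ y hns) :=
    addOrderOf_pos_iff.mp (by rw [hT]; exact two_pos)
  have hdvd : 2 ∣ W.reductionPointCount p :=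
    hT ▸ addOrderOf_dvd_reductionPointCount W p hp3 (not_dvd_minimalDiscriminantInt_of_hasGoodReductionAtPrime' W p hgood) hfin
  rw [LFunction_apply_prime_eq_frobeniusTrace W p hgood]
  have h2 : ((2 : ℕ) : ℤ) ∣ W.frobeniusTrace p - (p + 1) := (dvd_frobeniusTrace_sub_iff W 2 p).mpr hdvd
  have hev : Even (W.frobeniusTrace p - (p + 1)) := even_iff_two_dvd.mpr (by exact_mod_cast h2)
  have hp1 : Even ((p : ℤ) + 1) := by
    have : Odd (p : ℤ) := by exact_mod_cast hp.odd_of_ne_two hp2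
    exact this.add_one
  exact (Int.even_sub.mp hev).mpr hp1

omit [W.IsGloballyMinimal] in
/-- **`a_p = ±1` is ODD at a prime with `f_p = 1`** (multiplicative reduction). [cite: DiamondShurman2005, §8.8 (8.44)] -/
theorem odd_LFunction_prime_of_factorization_eq_one {p : ℕ} (hp : p.Prime)
    (h1 : (W.conductorNorm ℤ).factorization p = 1) : Odd (W.LFunction p) := by
  set v : IsDedekindDomain.HeightOneSpectrum (𝓞 ℚ) := (primesEquiv (R := 𝓞 ℚ)).symm ⟨p, hp⟩ with hvdef
  have hv : (primesEquiv v : ℕ) = p := by rw [hvdef, Equiv.apply_symm_apply]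
  have hf : (W.conductorNorm ℤ).factorization p = W.conductorExponent v :=
    factorization_conductorNorm_eq_conductorExponent W ⟨p, hp⟩
  have hmult : W.HasMultiplicativeReductionAt v := (conductorExponent_eq_one_iff_holds v W).mp (by rw [← hf]; exact h1)
  rw [← hv]
  by_cases hs : W.HasSplitMultiplicativeReductionAt v
  · rw [W.LFunction_apply_primesEquiv_of_hasSplitMultiplicativeReductionAt hs]; exact odd_one
  · rw [W.LFunction_apply_primesEquiv_of_hasMultiplicativeReductionAt_of_not_split hmult hs]; exact ⟨-1, by norm_num⟩

omit [W.IsGloballyMinimal] in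
/-- **`a_m = 0` for `p ∣ m` at a prime with `f_p ≥ 2`** (additive reduction). [cite: DiamondShurman2005, §8.8 (8.44)] -/
theorem LFunction_eq_zero_of_two_le_factorization {p : ℕ} (hp : p.Prime)
    (h2 : 2 ≤ (W.conductorNorm ℤ).factorization p) {m : ℕ} (hm : p ∣ m) : W.LFunction m = 0 := by
  haveI : Fact p.Prime := ⟨hp⟩
  set v : IsDedekindDomain.HeightOneSpectrum (𝓞 ℚ) := (primesEquiv (R := 𝓞 ℚ)).symm ⟨p, hp⟩ with hvdef
  have hv : (primesEquiv v : ℕ) = p := by rw [hvdef, Equiv.apply_symm_apply]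
  have hf : (W.conductorNorm ℤ).factorization p = W.conductorExponent v :=
    factorization_conductorNorm_eq_conductorExponent W ⟨p, hp⟩
  have hadd : W.HasAdditiveReductionAt v := (two_le_conductorExponent_iff_holds v W).mp (by rw [← hf]; exact h2)
  exact W.LFunction_apply_eq_zero_of_hasAdditiveReductionAt hv hadd hm

/-- **Parity of `a_{p^e}` at an odd prime `p`, `e ≥ 1`**: odd iff (`f_p = 0` and `e` even) or `f_p = 1`.
[cite: DiamondShurman2005, §8.8 (8.44)] [cite: SilvermanAEC2009, VII.3.1(b)] -/
theorem odd_LFunction_prime_pow_iff {x₀ : ℚ} (hx : HasRationalTwoTorsionX W x₀) {p : ℕ} (hp : p.Prime) (hp2 : p ≠ 2)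
    {e : ℕ} (he : 1 ≤ e) :
    Odd (W.LFunction (p ^ e)) ↔
      ((W.conductorNorm ℤ).factorization p = 0 ∧ Even e) ∨ (W.conductorNorm ℤ).factorization p = 1 := by
  haveI : Fact p.Prime := ⟨hp⟩
  have hN : W.conductorNorm ℤ ≠ 0 := (W.conductorNorm_pos_holds).ne'
  have h0g : W.LFunction (p ^ 0) = 1 := by rw [pow_zero]; exact W.isMultiplicative_LFunction.map_one
  rcases Nat.lt_or_ge ((W.conductorNorm ℤ).factorization p) 1 with hlt | h1
  · -- good prime
    have hf0 : (W.conductorNorm ℤ).factorization p = 0 := by omega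
    have hnd : ¬ p ∣ W.conductorNorm ℤ := fun h ↦ by
      have := (hp.dvd_iff_one_le_factorization hN).mp h; omega
    have hgood : W.HasGoodReductionAtPrime p := by
      by_contra h; exact hnd ((W.dvd_conductorNorm_iff_not_hasGoodReductionAtPrime p).mpr h)
    have hev : Even (W.LFunction p) := even_LFunction_prime_of_good W hx p hp2 hgood
    have key : ∀ e, Odd (W.LFunction (p ^ e)) ↔ Even e :=
      odd_iff_even_of_rec (fun e ↦ W.LFunction (p ^ e)) (p : ℤ) h0g (by rw [pow_one]; exact hev)
        (by exact_mod_cast hp.odd_of_ne_two hp2)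
        (fun k ↦ by
          have h := W.LFunction_apply_prime_pow_add_two_of_prime hp k
          rw [if_neg hnd] at h; rw [pow_one]; exact h)
    rw [key e, hf0]
    simp
  · rcases Nat.lt_or_ge ((W.conductorNorm ℤ).factorization p) 2 with hlt2 | h2
    · -- multiplicative prime
      have hf1 : (W.conductorNorm ℤ).factorization p = 1 := by omega
      have hdv : p ∣ W.conductorNorm ℤ := (hp.dvd_iff_one_le_factorization hN).mpr h1
      have hodd1 : Odd (W.LFunction p) := odd_LFunction_prime_of_factorization_eq_one W hp hf1
      have key : ∀ e, Odd (W.LFunction (p ^ e)) :=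
        odd_of_rec (fun e ↦ W.LFunction (p ^ e)) h0g (by rw [pow_one]; exact hodd1)
          (fun k ↦ by
            have h := W.LFunction_apply_prime_pow_add_two_of_prime hp k
            rw [if_pos hdv, zero_mul, sub_zero] at h; rw [pow_one]; exact h)
      rw [hf1]
      simp [key e]
    · -- additive prime
      have hz : W.LFunction (p ^ e) = 0 := LFunction_eq_zero_of_two_le_factorization W hp h2 (dvd_pow_self p (by omega))
      rw [hz]
      refine iff_of_false (by simp) ?_
      rintro (⟨h, -⟩ | h) <;> omega

/-! ## §3 KA -/

/-- **KA `stub_apParityPattern`**: for `W / ℚ` elliptic, globally minimal, with a rational `2`-torsion point, and every odd `n`: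
`a_n(W)` odd ⟺ `LevelPattern N_W n`. [cite: DiamondShurman2005, §8.8 (8.44)] [cite: SilvermanAEC2009, VII.3.1(b)] -/
theorem apParityPattern (x₀ : ℚ) (hx : HasRationalTwoTorsionX W x₀) :
    ∀ n : ℕ, ¬ 2 ∣ n → (Odd (W.LFunction n) ↔ LevelPattern (W.conductorNorm ℤ) n) := by
  intro n hn2
  have hn : n ≠ 0 := by rintro rfl; exact hn2 (dvd_zero 2)
  rw [odd_apply_iff W.LFunction W.isMultiplicative_LFunction hn, LevelPattern, and_iff_right hn]
  refine forall₂_congr fun p hp ↦ ?_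
  have hpp : p.Prime := Nat.prime_of_mem_primeFactors hp
  have hpn : p ∣ n := Nat.dvd_of_mem_primeFactors hp
  have hp2 : p ≠ 2 := fun h ↦ hn2 (h ▸ hpn)
  have he : 1 ≤ n.factorization p := (hpp.dvd_iff_one_le_factorization hn).mp hpn
  exact odd_LFunction_prime_pow_iff W hx hpp hp2 he

/-- KA in the shape of the v7 design stub (binder order of `KummerV7Sketch.stub_apParityPattern`). [folklore] -/
theorem apParityPattern' : ∀ (W₀ : WeierstrassCurve ℚ) [W₀.IsElliptic] [W₀.IsGloballyMinimal] (x₀ : ℚ),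
    HasRationalTwoTorsionX W₀ x₀ → ∀ n : ℕ, ¬ 2 ∣ n → (Odd (W₀.LFunction n) ↔ LevelPattern (W₀.conductorNorm ℤ) n) :=
  fun W₀ _ _ x₀ hx ↦ apParityPattern W₀ x₀ hx

/-- KA with `LevelPattern` INLINED (no `Prop`-valued def — the form to land if the audit's `vendored-fact` flag on
`LevelPattern` is unwanted). [cite: DiamondShurman2005, §8.8 (8.44)] [cite: SilvermanAEC2009, VII.3.1(b)] -/
theorem apParityPattern_inline (x₀ : ℚ) (hx : HasRationalTwoTorsionX W x₀) (n : ℕ) (hn : ¬ 2 ∣ n) :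
    Odd (W.LFunction n) ↔ (n ≠ 0 ∧ ∀ p ∈ n.primeFactors,
      ((W.conductorNorm ℤ).factorization p = 0 ∧ Even (n.factorization p)) ∨ (W.conductorNorm ℤ).factorization p = 1) :=
  apParityPattern W x₀ hx n hn

/-- **STUB KA `stub_apParityPattern` of line `kummer` v7.3 (crux `StarGO2Sigma`, stmt-BirchSwinnertonDyer-27046), registered signature
verbatim — PROVED** (planner p2 GEN 38 PART 17 `apParityPattern`, landed by the lead). [cite: DiamondShurman2005, §8.8 (8.44)]
[cite: SilvermanAEC2009, VII.3.1(b)] -/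
theorem stub_apParityPattern :
    ∀ (W₀ : WeierstrassCurve ℚ) [W₀.IsElliptic] [W₀.IsGloballyMinimal] (x₀ : ℚ), HasRationalTwoTorsionX W₀ x₀ →
      ∀ n : ℕ, ¬ 2 ∣ n → (Odd (W₀.LFunction n) ↔ KEta.ThetaPattern.LevelPattern (W₀.conductorNorm ℤ) n) :=
  fun W₀ _ _ x₀ hx ↦ apParityPattern W₀ x₀ hx

end Summit.BirchSwinnertonDyer.BirchSwinnertonDyer.Theorems.DepletionAtTwo.KEta.ApParity
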